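import Summits.AtomisticToContinuum.HydrodynamicLimit.Theses.LambertianContactSwap
import Literature.MathematicalPhysics.KineticTheory.HardSphereEulerProofs

/-!
# `LocalGibbsProbability` for route LambertianContactSwap

The local Gibbs laws `localGibbsLaw σ a₀ u₀ θ₀ N Φ` of `N + 1` hard spheres of reduced diameter
`σ` on `𝕋³`, with continuous profiles `a₀, θ₀ > 0` and `u₀`, are probability measures for every
`0 < σ < σ₀ := 1/2` and every `N`: this is the in-tree Literature theorem
`Literature.MathematicalPhysics.KineticTheory.isProbabilityMeasure_localGibbsLaw` (hypothesis
`σ ≤ 1/2`; the partition function is finite by Maxwellian tails and positive because `N + 1`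
spheres of diameter `σ (N+1)^{-1/3}` fit on a cubic sub-lattice of the torus).
-/

namespace Summit.AtomisticToContinuum.HydrodynamicLimit.Theorems

/-- **Local Gibbs laws are probability measures at small reduced density** (route
LambertianContactSwap, support item `LocalGibbsProbability`): with `σ₀ = 1/2`, for every
`0 < σ < σ₀`, continuous profiles `a₀, θ₀ > 0`, `u₀`, every `N` and every hard-sphere flow `Φ`,
`localGibbsLaw σ a₀ u₀ θ₀ N Φ` is a probability measure. Immediate from
`Literature.MathematicalPhysics.KineticTheory.isProbabilityMeasure_localGibbsLaw`. [folklore;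
cf. Ruelle 1969 (canonical ensemble), Spohn 1991 Part I §2.3] -/
theorem localGibbsProbability_proof :
    Summit.AtomisticToContinuum.HydrodynamicLimit.Theses.LambertianContactSwap.LocalGibbsProbability := by
  unfold Summit.AtomisticToContinuum.HydrodynamicLimit.Theses.LambertianContactSwap.LocalGibbsProbability
  refine ⟨1 / 2, one_half_pos, ?_⟩
  intro σ _hσ hσ₀ a₀ θ₀ u₀ ha hθ hu ha0 hθ0 N Φ
  exact Literature.MathematicalPhysics.KineticTheory.isProbabilityMeasure_localGibbsLaw
    ha hθ hu ha0 hθ0 hσ₀.le N Φ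

end Summit.AtomisticToContinuum.HydrodynamicLimit.Theorems
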